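import Literature.NumberTheory.PAdicHodge.CompletedAlgClosurePadicComplexOfEmbedding
import Literature.NumberTheory.GaloisRepresentations.LubinTateComparisonTraceTransportTwo
import Literature.NumberTheory.EllipticCurves.PAdicTwoVariableTransformCharacter
import HarnessLib

/-!
# The reading `Θ = θ ∘ (𝐃 → 𝒪_{ℂ_F})` in `ℂ_[p]` along a continuous embedding `φ : F → ℚ_p`:
# `hΘe : Θ ∘ (𝒪[F] → 𝐃) = padicIntCast ∘ e` for every `e : 𝒪[F] → ℤ_p` over `φ` (generic `F`; the `F = ℚ₂` case is
# `PadicTwo.theta_intToUnrCoeff_eq_padicIntCast`)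

Topic `NumberTheory/EllipticCurves`; namespace `Literature.NumberTheory.EllipticCurves`. Cell `bsd-print-cf2`
(HOME `run/shared/lean/pub/bsd-print-cf2/`), width seat `bsd-line-cf2-p1-w7` g11.

The measure-side recipe of de Shalit I.3.4 / II.4.6 (`PAdicOneVariable{SeriesFamily,NormCoherentUnit…}OfCharacter.lean`,
`…EquivarianceOfComparison.lean`) is generic in the local field `F` with `|𝓀_F| = 2` and reads `𝐃 = 𝒪̂_{F^nr}`-series in a normed
field over `ℚ_p` through a coefficient map `Θ : 𝐃 →+* 𝕜` subject to ONE compatibility, `hΘe : Θ ∘ intToUnrCoeff = padicIntCast ∘ e`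
for a ring map `e : 𝒪[F] →+* ℤ_[p]`.  For `F` LITERALLY `ℚ_[2]` the tree discharges it with `Θ := θ₀ ∘ (𝐃 → 𝒪_{ℂ_F} ⊆ ℂ_F)`,
`θ₀ = CompletedAlgClosure.equivPadicComplex 2` (`PadicTwoEquivarianceOfComparison.lean`).  THIS file does the same for EVERY
`p`-adic local field `F` continuously embedded in `ℚ_p` by `φ` (so for the completions `K_v ≅ ℚ_p` at places of degree one, de Shalit's
`K_𝔭 = ℚ_p`): with `θ : ℂ_F →+* ℂ_[p]` over `φ` (`θ ∘ algebraMap F = coe ∘ φ`; such `θ` exist and are norm-`≤ 1` on `𝒪_{ℂ_F}`: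
`CompletedAlgClosure.exists_ringHom_padicComplex_of_continuous`, this seat's `CompletedAlgClosurePadicComplexOfEmbedding.lean`),

* ★ `theta_intToUnrCoeff_eq_padicIntCast_of_algebraMap` — **`hΘe` holds for `Θ := θ ∘ (𝐃 → 𝒪_{ℂ_F} ⊆ ℂ_F)` and every `e : 𝒪[F] →+* ℤ_[p]`
  with `↑(e a) = φ a`** (pure rewriting: `coe_algebraMap_intToUnrCoeff`, `padicIntCast_apply`);
* ★ `exists_theta_reading_of_continuous` — **there is `θ : ℂ_F →+* ℂ_[p]`, continuous and bijective, of norm `≤ 1` on `𝒪_{ℂ_F}` (`hθ1`),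
  strict on the open unit ball, equal to `φ` on `F`, satisfying `hΘe` for every `e` over `φ`.**

Theorems only; no definition, no named fact, no instance, no `sorry`.  HONEST FRAMING: plumbing; BSD is not advanced by this file.

## References
* [deShalit1987] E. de Shalit, *Iwasawa theory of elliptic curves with complex multiplication* (1987), I.3.1 (p. 13: `𝐃`-valued measures,
  `ℤ_p ⊆ 𝐃`), I.3.3–3.4 (p. 17–18), II.1.1 (p. 32: `K_𝔭 = ℚ_p` at a split prime).
-/

noncomputable section

namespace Literature.NumberTheory.EllipticCurves

open ValuativeRel Field
open Literature.NumberTheory.GaloisRepresentations Literature.NumberTheory.GaloisRepresentations.IsNonarchimedeanLocalField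
  Literature.NumberTheory.GaloisRepresentations.LubinTate Literature.NumberTheory.PAdicHodge

variable {F : Type} [Field F] [ValuativeRel F] [TopologicalSpace F] [IsNonarchimedeanLocalField F]
variable (p : ℕ) [hp : Fact p.Prime]

/-- ★ **`hΘe` from `θ = φ` on `F` and `e = φ` on `𝒪[F]`.**  Let `φ : F →+* ℚ_[p]`, `θ : ℂ_F →+* ℂ_[p]` with `θ (algebraMap F ℂ_F a) = φ a`,
and `e : 𝒪[F] →+* ℤ_[p]` with `↑(e a) = φ a`.  Then for `Θ := θ ∘ (𝐃 → 𝒪_{ℂ_F} ⊆ ℂ_F)` (`𝐃 = UnrCoeff F = 𝒪̂_{F^nr}`):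
`Θ (intToUnrCoeff F a) = padicIntCast ℂ_[p] (e a)` for all `a ∈ 𝒪[F]` — the compatibility `hΘe` of the measure-side files.
(`𝒪[F] → 𝐃 → 𝒪_{ℂ_F}` is `F ⊆ ℂ_F`: `coe_algebraMap_intToUnrCoeff`; `padicIntCast ℂ_[p] z = algebraMap ℚ_[p] ℂ_[p] z`.)
[cite: deShalit1987, I.3.1 (p. 13), I.3.4 (p. 18)] -/
theorem theta_intToUnrCoeff_eq_padicIntCast_of_algebraMap (φ : F →+* ℚ_[p]) (θ : CompletedAlgClosure F →+* ℂ_[p])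
    (hθφ : ∀ a : F, θ (algebraMap F (CompletedAlgClosure F) a) = ((φ a : ℚ_[p]) : ℂ_[p]))
    (e : 𝒪[F] →+* ℤ_[p]) (he : ∀ a : 𝒪[F], ((e a : ℤ_[p]) : ℚ_[p]) = φ (a : F)) (a : 𝒪[F]) :
    (θ.comp ((CBall F).subtype.comp (algebraMap (UnrCoeff F) (CBall F)))) (intToUnrCoeff F a) = padicIntCast ℂ_[p] (e a) := by
  rw [RingHom.comp_apply, RingHom.comp_apply, Subring.subtype_apply, coe_algebraMap_intToUnrCoeff, hθφ, padicIntCast_apply, he]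
  rfl

/-- ★ **A reading `θ : ℂ_F →+* ℂ_[p]` over a continuous `φ : F → ℚ_p`, with `hθ1` and `hΘe` for every `e` over `φ`.**  For a
non-archimedean local field `F` of characteristic `0` with `|p|_F < 1` and a continuous ring map `φ : F →+* ℚ_[p]` there is a continuous
bijective ring map `θ : ℂ_F →+* ℂ_[p]` with `‖θ z‖ ≤ 1` on `𝒪_{ℂ_F}`, `‖θ z‖ < 1` on the open unit ball, `θ ∘ algebraMap F = coe ∘ φ`, and
`(θ ∘ (𝐃 → 𝒪_{ℂ_F} ⊆ ℂ_F)) ∘ intToUnrCoeff = padicIntCast ∘ e` for EVERY `e : 𝒪[F] →+* ℤ_[p]` with `↑(e a) = φ a`.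
[cite: deShalit1987, I.3.4 (p. 18), II.1.1 (p. 32)] -/
theorem exists_theta_reading_of_continuous [CharZero F] (φ : F →+* ℚ_[p]) (hφ : Continuous φ)
    (hF : valuation F (p : F) < 1) :
    ∃ θ : CompletedAlgClosure F →+* ℂ_[p], Continuous θ ∧ Function.Bijective θ ∧
      (∀ z : CBall F, ‖θ (z : CompletedAlgClosure F)‖ ≤ 1) ∧
      (∀ z : CompletedAlgClosure F, ‖z‖ < 1 → ‖θ z‖ < 1) ∧
      (∀ a : F, θ (algebraMap F (CompletedAlgClosure F) a) = ((φ a : ℚ_[p]) : ℂ_[p])) ∧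
      ∀ (e : 𝒪[F] →+* ℤ_[p]), (∀ a : 𝒪[F], ((e a : ℤ_[p]) : ℚ_[p]) = φ (a : F)) → ∀ a : 𝒪[F],
        (θ.comp ((CBall F).subtype.comp (algebraMap (UnrCoeff F) (CBall F)))) (intToUnrCoeff F a) = padicIntCast ℂ_[p] (e a) := by
  obtain ⟨θ, hθ1, hθlt, hθφ, hθbij, hθc⟩ := CompletedAlgClosure.exists_ringHom_padicComplex_of_continuous p φ hφ hF
  exact ⟨θ, hθc, hθbij, fun z => hθ1 z z.2, hθlt, hθφ,
    fun e he a => theta_intToUnrCoeff_eq_padicIntCast_of_algebraMap p φ θ hθφ e he a⟩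

end Literature.NumberTheory.EllipticCurves

end
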